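import Summits.ResolutionOfSingularities.ResolutionOfSingularities.Theorems.FrobeniusClosingSteerSwitchBinaryExceptionalTwiceRun
import Summits.ResolutionOfSingularities.ResolutionOfSingularities.Theorems.FrobeniusClosingSteerBinaryResidueEvenSatellite
import HarnessLib

/-!
# hARᵒ H2 — F4ʳᵘⁿ: **the even-satellite assembly AT RUN LEVEL** — case (β) of the H2ₘ decomposition: four consecutive visits
# `j₀` (an A-stage), `j₁`, `j₂`, `N′` with the tracked parameter `x` exceptional at `j₀` AND `j₁` and a SATELLITE step after `j₂`
# (`x/x₂ ∈ 𝔪`) give an ON-AXIS BINARY datum at `j₀` (Theses-free, def-free)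

OURS (campaign `res-hironaka`, rung L ★L-G4, slot W4.1 · crux `Steer` (stmt-ResolutionOfSingularities-16345) · hARᵒ slot H2; P0 brief
`L/res-L0-w41-plan-1/P0-BRIEF-hARo.md` b66a17a38113b83f §«Remaining objects» 4; design res-type-062 g15 `H2-DESIGN.md` 7dac75913b6b98e3 §5 (β);
seat res-D-repro-2 g9, P0 main hand). The run plumbing (that of F3ʳᵘⁿ p556495 / Fβʳᵘⁿ p558172) over the four-member kernel F4b
`BinaryResidue.binaryResidue_of_evenSatellite`; the A-stage at `j₂` is Fβʳᵘⁿ `aStage_of_exceptional_twice_run`. Not a statement of the manuscript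
under review [claim: Hironaka2017, status: under-review]; AI-produced, weaker than expert review.

INPUTS: steered run at `p = 2`, characteristic `2`, `R 0` dominated by `O`, regular members of dimension `4`; visit pairs `(j₀, j₁)`, `(j₁, j₂)`,
`(j₂, N′)` with Hγ (along `x`, `x`, `x₂`); `j₀` an A-stage of reduced order `d ≥ 3`; reduced order `d` at `j₁`, `j₂`, `N′` (S1b); `x` an exceptional
parameter of the point steps `j₀` and `j₁`, `x₂` one of `j₂`; the SATELLITE condition `x/x₂ ∈ 𝔪_{R (j₂+1)}`; N4's height-one clause at `j₁`,
`j₂`, `N′`; rationality of the three point windows (value form). OUTPUT: the (H2)-datum of `ArithReductionLegality.arithSwitchClause_of_H2` at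
`i := j₀` with `u := x`. [cite: Matsumura1987, Thm. 14.2] [folklore]
-/

noncomputable section

-- `Summit.<S>.<S>.…` duplicates the summit name by design (single-problem summit).
set_option linter.dupNamespace false

open IsLocalRing MvPolynomial

namespace Summit.ResolutionOfSingularities.ResolutionOfSingularities.Theorems.SwitchingDichotomy.BinaryResidue

open Literature.AlgebraicGeometry.Resolution
open Summit.ResolutionOfSingularities.ResolutionOfSingularities.Theorems.SwitchingDichotomy.Words
  (HasClordAlongAt HasCleanedOrderAt HasReducedOrderAt IsOddDivisorAt NoOddDivisorAt IsAStageAt IsSteeredRun IsVisitPair IsPointStep)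

variable {K : Type} [Field K] {O : ValuationSubring K} {R : ℕ → Subring K} {P : (i : ℕ) → Ideal (R i)} {t : K} {s : ℕ → K}

/-- **F4ʳᵘⁿ — an even satellite after a B-stage forces an ON-AXIS BINARY A-stage (run level).** See the module docstring.
[cite: Matsumura1987, Thm. 14.2, Thm. 17.10] [folklore] -/
theorem binaryAStage_of_evenSatellite_run [CharP K 2] (hrun : IsSteeredRun O R P t 2 s) (hR0 : SubringDominates (R 0) O.toSubring)
    (hreg : ∀ i, IsRegularLocalRing (R i)) (hdim : ∀ i, ringKrullDim (R i) = (4 : ℕ))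
    {j₀ j₁ j₂ N : ℕ} (hv₀ : IsVisitPair R P j₀ j₁) (hv₁ : IsVisitPair R P j₁ j₂) (hv₂ : IsVisitPair R P j₂ N)
    {d : ℕ} (hd : 3 ≤ d) (hA : IsAStageAt R P s 2 j₀ d)
    (hredj₁ : HasReducedOrderAt R s 2 j₁ d) (hredj₂ : HasReducedOrderAt R s 2 j₂ d) (hredN : HasReducedOrderAt R s 2 N d)
    {x : K} (hx : (∃ h : x ∈ R j₀, (⟨x, h⟩ : R j₀) ∈ P j₀) ∧ x ≠ 0 ∧ ∀ y : R j₀, y ∈ P j₀ → O.valuation (y : K) ≤ O.valuation x)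
    (Hγ₀ : ∀ k, j₀ < k → k < j₁ → ∃ hx : x ∈ R k, P k = Ideal.span {(⟨x, hx⟩ : R k)})
    (hx' : (∃ h : x ∈ R j₁, (⟨x, h⟩ : R j₁) ∈ P j₁) ∧ x ≠ 0 ∧ ∀ y : R j₁, y ∈ P j₁ → O.valuation (y : K) ≤ O.valuation x)
    (Hγ₁ : ∀ k, j₁ < k → k < j₂ → ∃ hx : x ∈ R k, P k = Ideal.span {(⟨x, hx⟩ : R k)})
    {x₂ : K} (hx₂ : (∃ h : x₂ ∈ R j₂, (⟨x₂, h⟩ : R j₂) ∈ P j₂) ∧ x₂ ≠ 0 ∧ ∀ y : R j₂, y ∈ P j₂ → O.valuation (y : K) ≤ O.valuation x₂)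
    (Hγ₂ : ∀ k, j₂ < k → k < N → ∃ hx₂ : x₂ ∈ R k, P k = Ideal.span {(⟨x₂, hx₂⟩ : R k)})
    (hsat : ∃ h : x / x₂ ∈ R (j₂ + 1), (⟨x / x₂, h⟩ : R (j₂ + 1)) ∈ maximalIdeal (R (j₂ + 1)))
    (h1j₁ : ∀ (hs' : s j₁ ^ 2 ∈ R j₁) (Q : Ideal (R j₁)) [Q.IsPrime], Q.height = 1 →
      ¬ SigmaTopLegality.IsSingPrime (R j₁) 2 ⟨s j₁ ^ 2, hs'⟩ Q)
    (h1j₂ : ∀ (hs' : s j₂ ^ 2 ∈ R j₂) (Q : Ideal (R j₂)) [Q.IsPrime], Q.height = 1 →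
      ¬ SigmaTopLegality.IsSingPrime (R j₂) 2 ⟨s j₂ ^ 2, hs'⟩ Q)
    (h1N : ∀ (hs' : s N ^ 2 ∈ R N) (Q : Ideal (R N)) [Q.IsPrime], Q.height = 1 →
      ¬ SigmaTopLegality.IsSingPrime (R N) 2 ⟨s N ^ 2, hs'⟩ Q)
    (hrat₀ : ∀ a ∈ R j₁, ∃ b ∈ R j₀, O.valuation (a - b) < 1)
    (hrat₁ : ∀ a ∈ R j₂, ∃ b ∈ R j₁, O.valuation (a - b) < 1)
    (hrat₂ : ∀ a ∈ R N, ∃ b ∈ R j₂, O.valuation (a - b) < 1) :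
    ∃ (_ : IsLocalRing (R j₀)) (hs : s j₀ ^ 2 ∈ R j₀) (g m₁ m₂ : R j₀) (Ψ : MvPolynomial (Fin 2) (R j₀)),
      IsRsopPart ![m₁, m₂] ∧ Ψ.IsHomogeneous d ∧
      (⟨s j₀ ^ 2, hs⟩ : R j₀) - g ^ 2 - MvPolynomial.eval ![m₁, m₂] Ψ ∈ maximalIdeal (R j₀) ^ (d + 1) ∧
      O.valuation (m₁ : K) < O.valuation x ∧ O.valuation (m₂ : K) < O.valuation x := by
  classical
  -- members are local, regular domains, dominated by `O`
  haveI hloc : ∀ i, IsLocalRing (R i) := fun i => VisitLawPointStep.isLocalRing_of_run hrun i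
  have hdom : ∀ i, SubringDominates (R i) O.toSubring := fun i => VisitLawPointStep.subringDominates_of_run hrun hR0 i
  have hbl : ∀ i, IsLocalBlowupAlong O (R i) (P i) (R (i + 1)) := fun i => VisitLawPointStep.isLocalBlowupAlong_of_run hrun i
  have hval : ∀ i (a : R i), a ∈ maximalIdeal (R i) ↔ O.valuation (a : K) < 1 := fun i =>
    (subringDominates_valuationSubring_iff (hdom i).1).mp (hdom i)
  -- `j₂` is an A-stage (Fβʳᵘⁿ)
  have hA₂ : IsAStageAt R P s 2 j₂ d :=
    aStage_of_exceptional_twice_run hrun hR0 hreg hdim hv₀ hv₁ hd hA hredj₁ hredj₂ hx Hγ₀ hx' Hγ₁ h1j₁ h1j₂ hrat₀ hrat₁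
  obtain ⟨hpt₀, -, hdodd, hclean₀⟩ := hA
  obtain ⟨hpt₂, -, -, hclean₂⟩ := hA₂
  have h2d : 2 ≤ d := by omega
  have hd2 : d % 2 = 1 := Nat.odd_iff.mp hdodd
  -- visit law at (j₀, j₁) with `ν = d`
  obtain ⟨⟨hRj₁, G, W, hG, hW, hWinv, hW0, hlaw⟩, -, hclord⟩ :=
    VisitLawDelta.visitLaw₂_of_run hrun hR0 hv₀ hx Hγ₀ hreg h1j₁ h2d hclean₀
  obtain ⟨instj₀, hPj₀⟩ := hpt₀
  obtain ⟨instj₁, hPj₁⟩ := hv₀.2.2.1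
  have hpt₁ : IsPointStep R P j₁ := hv₀.2.2.1
  obtain ⟨instj₂, hPj₂⟩ := hpt₂
  -- `x` at `j₀ + 1`: regular parameter
  have hx1 : x ∈ R (j₀ + 1) := (hbl j₀).isLocalBlowup.le hx.1.fst
  obtain ⟨hxm₁, hx2₁, -⟩ := VisitLawPointStep.prime_excParam_succ hrun hR0 ⟨instj₀, hPj₀⟩ (hreg j₀) (hreg (j₀ + 1)) hx hx1
  -- `x` odd at `j₁` ⇒ `ν_{j₁} = d + 1`
  rw [hd2] at hclord
  have hodd₁ : IsOddDivisorAt R s 2 j₁ x := by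
    have key : ∀ (S : Subring K) (hS : S = R (j₀ + 1)) (hxS : x ∈ S) [IsLocalRing S],
        (⟨x, hxS⟩ : S) ∈ maximalIdeal S ∧ (⟨x, hxS⟩ : S) ∉ maximalIdeal S ^ 2 := by
      intro S hS hxS _; subst hS; exact ⟨hxm₁, hx2₁⟩
    obtain ⟨hm, hm2⟩ := key (R j₁) hRj₁ (hRj₁ ▸ hx1)
    exact ⟨hloc j₁, hRj₁ ▸ hx1, hm, hm2, 1, odd_one, hclord⟩
  have hν₁ : HasCleanedOrderAt R s 2 j₁ (d + 1) := by
    obtain ⟨ν, hν, hcase⟩ := hredj₁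
    rcases hcase with ⟨hno, -⟩ | ⟨-, hdν⟩
    · exact absurd hodd₁ (hno x)
    · rw [hdν]; exact hν
  -- visit law at (j₁, j₂) with `ν = d + 1`, along `x` again
  have h2d1 : 2 ≤ d + 1 := by omega
  obtain ⟨⟨hRj₂, G₁, W₁, hG₁, hW₁, -, -, hlaw₂⟩, -, -⟩ :=
    VisitLawDelta.visitLaw₂_of_run hrun hR0 hv₁ hx' Hγ₁ hreg h1j₂ h2d1 hν₁
  -- `x` at `j₁ + 1`: regular parameter (x exceptional at `j₁`)
  have hx1' : x ∈ R (j₁ + 1) := (hbl j₁).isLocalBlowup.le hx'.1.fst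
  obtain ⟨hxm₂, hx2₂, -⟩ := VisitLawPointStep.prime_excParam_succ hrun hR0 hpt₁ (hreg j₁) (hreg (j₁ + 1)) hx' hx1'
  -- visit law at (j₂, N) with `ν = d`, along `x₂`
  obtain ⟨⟨hRN, G₂, W₂, hG₂, hW₂, -, -, hlaw₃⟩, -, hclord₃⟩ :=
    VisitLawDelta.visitLaw₂_of_run hrun hR0 hv₂ hx₂ Hγ₂ hreg h1N h2d hclean₂
  rw [hd2] at hclord₃
  -- `x₂` at `j₂ + 1`: regular parameter ⇒ odd divisor at `N` ⇒ `ν_N = d + 1`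
  have hx₂1 : x₂ ∈ R (j₂ + 1) := (hbl j₂).isLocalBlowup.le hx₂.1.fst
  obtain ⟨hx₂m, hx₂2, -⟩ := VisitLawPointStep.prime_excParam_succ hrun hR0 ⟨instj₂, hPj₂⟩ (hreg j₂) (hreg (j₂ + 1)) hx₂ hx₂1
  have hoddN : IsOddDivisorAt R s 2 N x₂ := by
    have key : ∀ (S : Subring K) (hS : S = R (j₂ + 1)) (hxS : x₂ ∈ S) [IsLocalRing S],
        (⟨x₂, hxS⟩ : S) ∈ maximalIdeal S ∧ (⟨x₂, hxS⟩ : S) ∉ maximalIdeal S ^ 2 := by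
      intro S hS hxS _; subst hS; exact ⟨hx₂m, hx₂2⟩
    obtain ⟨hm, hm2⟩ := key (R N) hRN (hRN ▸ hx₂1)
    exact ⟨hloc N, hRN ▸ hx₂1, hm, hm2, 1, odd_one, hclord₃⟩
  have hνN : HasCleanedOrderAt R s 2 N (d + 1) := by
    obtain ⟨ν, hν, hcase⟩ := hredN
    rcases hcase with ⟨hno, -⟩ | ⟨-, hdν⟩
    · exact absurd hoddN (hno x₂)
    · rw [hdν]; exact hν
  -- the four members `S₀ = R j₀ ≤ S₁ = R (j₀+1) ≤ S₂ = R (j₁+1) ≤ S₃ = R (j₂+1)`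
  have h01 : R j₀ ≤ R (j₀ + 1) := (hbl j₀).isLocalBlowup.le
  have h12 : R (j₀ + 1) ≤ R (j₁ + 1) := hRj₁ ▸ (hbl j₁).isLocalBlowup.le
  have h23 : R (j₁ + 1) ≤ R (j₂ + 1) := hRj₂ ▸ (hbl j₂).isLocalBlowup.le
  haveI := hreg j₀; haveI := hreg (j₀ + 1); haveI := hreg (j₁ + 1); haveI := hreg (j₂ + 1)
  -- maximality clauses transported (valuation form)
  have hxmaxv : ∀ y : K, y ∈ R (j₀ + 1) → O.valuation y < 1 → O.valuation y ≤ O.valuation x := by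
    have h' : ∀ y : K, y ∈ R j₁ → O.valuation y < 1 → O.valuation y ≤ O.valuation x := by
      intro y hy hv
      exact hx'.2.2 ⟨y, hy⟩ (hPj₁ ▸ (hval j₁ ⟨y, hy⟩).mpr hv)
    rw [hRj₁] at h'; exact h'
  have hxmax₁ : ∀ y : R (j₀ + 1), y ∈ maximalIdeal (R (j₀ + 1)) → O.valuation (y : K) ≤ O.valuation x :=
    fun y hy => hxmaxv y y.2 ((hval _ y).mp hy)
  have hx₂R : x₂ ∈ R (j₁ + 1) := hRj₂ ▸ hx₂.1.fst
  have hx₂maxv : ∀ y : K, y ∈ R (j₁ + 1) → O.valuation y < 1 → O.valuation y ≤ O.valuation x₂ := by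
    have h' : ∀ y : K, y ∈ R j₂ → O.valuation y < 1 → O.valuation y ≤ O.valuation x₂ := by
      intro y hy hv
      exact hx₂.2.2 ⟨y, hy⟩ (hPj₂ ▸ (hval j₂ ⟨y, hy⟩).mpr hv)
    rw [hRj₂] at h'; exact h'
  have hx₂m' : (⟨x₂, hx₂R⟩ : R (j₁ + 1)) ∈ maximalIdeal (R (j₁ + 1)) := by
    rw [hval]
    obtain ⟨h, hP⟩ := hx₂.1
    exact (hval j₂ ⟨x₂, h⟩).mp (hPj₂ ▸ hP)
  have hx₂max' : ∀ y : R (j₁ + 1), y ∈ maximalIdeal (R (j₁ + 1)) → O.valuation (y : K) ≤ O.valuation x₂ :=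
    fun y hy => hx₂maxv y y.2 ((hval _ y).mp hy)
  -- the three quadratic transforms in chart form
  have hbl₀ : IsLocalBlowupAlong O (R j₀) (maximalIdeal (R j₀)) (R (j₀ + 1)) := by
    have h := hbl j₀; rw [hPj₀] at h; exact h
  have hxm₀ : (⟨x, hx.1.fst⟩ : R j₀) ∈ maximalIdeal (R j₀) := hPj₀ ▸ hx.1.snd
  have hxmax₀ : ∀ y : R j₀, y ∈ maximalIdeal (R j₀) → O.valuation (y : K) ≤ O.valuation x :=
    fun y hy => hx.2.2 y (hPj₀ ▸ hy)
  have hR₁ : R (j₀ + 1) = locAtCentre (blowupRing (R j₀) x) O :=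
    DivisorTrigger.eq_locAtCentre_blowupRing hbl₀ hx.1.fst hxm₀ hx.2.1 hxmax₀
  have hbl₁ : IsLocalBlowupAlong O (R (j₀ + 1)) (maximalIdeal (R (j₀ + 1))) (R (j₁ + 1)) := by
    have key : ∀ (S : Subring K) (hS : S = R j₁) [IsLocalRing S], IsLocalBlowupAlong O S (maximalIdeal S) (R (j₁ + 1)) := by
      intro S hS _; subst hS
      have h := hbl j₁; rw [hPj₁] at h; exact h
    exact key _ hRj₁.symm
  have hR₂ : R (j₁ + 1) = locAtCentre (blowupRing (R (j₀ + 1)) x) O :=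
    DivisorTrigger.eq_locAtCentre_blowupRing hbl₁ hx1 hxm₁ hx.2.1 hxmax₁
  have hbl₂ : IsLocalBlowupAlong O (R (j₁ + 1)) (maximalIdeal (R (j₁ + 1))) (R (j₂ + 1)) := by
    have key : ∀ (S : Subring K) (hS : S = R j₂) [IsLocalRing S], IsLocalBlowupAlong O S (maximalIdeal S) (R (j₂ + 1)) := by
      intro S hS _; subst hS
      have h := hbl j₂; rw [hPj₂] at h; exact h
    exact key _ hRj₂.symm
  have hR₃ : R (j₂ + 1) = locAtCentre (blowupRing (R (j₁ + 1)) x₂) O :=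
    DivisorTrigger.eq_locAtCentre_blowupRing hbl₂ hx₂R hx₂m' hx₂.2.1 hx₂max'
  -- rationality in the tree's form
  have hrat₀' : ∀ a : R (j₀ + 1), ∃ b : R j₀, a - ⟨(b : K), h01 b.2⟩ ∈ maximalIdeal (R (j₀ + 1)) := by
    intro a
    have ha : (a : K) ∈ R j₁ := by rw [hRj₁]; exact a.2
    obtain ⟨b, hb, hvb⟩ := hrat₀ a ha
    exact ⟨⟨b, hb⟩, (hval _ _).mpr (by simpa using hvb)⟩
  have hrat₁' : ∀ a : R (j₁ + 1), ∃ b : R (j₀ + 1), a - ⟨(b : K), h12 b.2⟩ ∈ maximalIdeal (R (j₁ + 1)) := by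
    intro a
    have ha : (a : K) ∈ R j₂ := by rw [hRj₂]; exact a.2
    obtain ⟨b, hb, hvb⟩ := hrat₁ a ha
    have hb' : b ∈ R (j₀ + 1) := by rw [← hRj₁]; exact hb
    exact ⟨⟨b, hb'⟩, (hval _ _).mpr (by simpa using hvb)⟩
  have hrat₂' : ∀ a : R (j₂ + 1), ∃ b : R (j₁ + 1), a - ⟨(b : K), h23 b.2⟩ ∈ maximalIdeal (R (j₂ + 1)) := by
    intro a
    have ha : (a : K) ∈ R N := by rw [hRN]; exact a.2
    obtain ⟨b, hb, hvb⟩ := hrat₂ a ha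
    have hb' : b ∈ R (j₁ + 1) := by rw [← hRj₂]; exact hb
    exact ⟨⟨b, hb'⟩, (hval _ _).mpr (by simpa using hvb)⟩
  -- the windows: two along `x`, the third along `x₂` with the prescribed satellite parameter `x`
  have hdim₀' : ringKrullDim (R j₀) = ((3 : ℕ) + 1 : ℕ) := by rw [hdim]
  have hdim₁' : ringKrullDim (R (j₀ + 1)) = ((3 : ℕ) + 1 : ℕ) := by rw [hdim]
  have hdim₂' : ringKrullDim (R (j₁ + 1)) = ((3 : ℕ) + 1 : ℕ) := by rw [hdim]
  obtain ⟨u, u', hxu, hu, hm₁⟩ := exists_adapted_window (hdom j₀) (hdom (j₀ + 1)) hdim₀' ⟨x, hx.1.fst⟩ hxm₀ hx.2.1 hxmax₀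
    hR₁ h01 hdim₁' hrat₀'
  obtain ⟨v, v', hxv, hv, hm₂⟩ := exists_adapted_window (hdom (j₀ + 1)) (hdom (j₁ + 1)) hdim₁' ⟨x, hx1⟩ hxm₁ hx.2.1 hxmax₁
    hR₂ h12 hdim₂' hrat₁'
  have hdim₂'' : ringKrullDim (R (j₁ + 1)) = ((2 : ℕ) + 1 + 1 : ℕ) := by rw [hdim]
  have hdim₃'' : ringKrullDim (R (j₂ + 1)) = ((2 : ℕ) + 1 + 1 : ℕ) := by rw [hdim]
  have hpx : ∃ h : ((⟨x, hx1'⟩ : R (j₁ + 1)) : K) / ((⟨x₂, hx₂R⟩ : R (j₁ + 1)) : K) ∈ R (j₂ + 1),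
      (⟨_, h⟩ : R (j₂ + 1)) ∈ maximalIdeal (R (j₂ + 1)) := hsat
  obtain ⟨w, w', hw0, hx₂w, hw, hm₃⟩ := exists_adapted_window_cons (hdom (j₁ + 1)) (hdom (j₂ + 1)) hdim₂'' ⟨x₂, hx₂R⟩ hx₂m'
    hx₂.2.1 hx₂max' hR₃ h23 hdim₃'' hrat₂' ⟨x, hx1'⟩ hxm₂ hx2₂ hpx
  have hw0L : ((w 0 : R (j₁ + 1)) : K) = x := by rw [hw0]
  -- characteristic 2, radicands as members
  have h2 : (2 : K) = 0 := CharTwo.two_eq_zero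
  obtain ⟨_, hs₀, ⟨G₀, hG₀⟩, -⟩ := hclean₀
  have hsj₁ : s j₁ ^ 2 ∈ R (j₀ + 1) := by rw [← hRj₁]; exact VisitLawPointStep.pow_mem_of_run hrun j₁
  have hGR : G ∈ R (j₀ + 1) := by rw [← hRj₁]; exact hG
  have hWR : W ∈ R (j₀ + 1) := by rw [← hRj₁]; exact hW
  have hsj₂ : s j₂ ^ 2 ∈ R (j₁ + 1) := by rw [← hRj₂]; exact VisitLawPointStep.pow_mem_of_run hrun j₂
  have hG₁R : G₁ ∈ R (j₁ + 1) := by rw [← hRj₂]; exact hG₁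
  have hW₁R : W₁ ∈ R (j₁ + 1) := by rw [← hRj₂]; exact hW₁
  have hsN : s N ^ 2 ∈ R (j₂ + 1) := by rw [← hRN]; exact VisitLawPointStep.pow_mem_of_run hrun N
  have hG₂R : G₂ ∈ R (j₂ + 1) := by rw [← hRN]; exact hG₂
  have hW₂R : W₂ ∈ R (j₂ + 1) := by rw [← hRN]; exact hW₂
  set f₀ : R j₀ := ⟨s j₀ ^ 2, hs₀⟩ with hf₀
  set f₁ : R (j₀ + 1) := ⟨s j₁ ^ 2, hsj₁⟩ with hf₁
  set f₂ : R (j₁ + 1) := ⟨s j₂ ^ 2, hsj₂⟩ with hf₂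
  set f₃ : R (j₂ + 1) := ⟨s N ^ 2, hsN⟩ with hf₃
  -- the squared laws
  set e := (d + 1) / 2 with he
  have hde : d + 1 = 2 * e := by omega
  have hm : d - 1 = 2 * (d / 2) := by omega
  have hlaw₁' : ((f₁ : R (j₀ + 1)) : K) * x ^ (d - 1) * ((⟨W, hWR⟩ : R (j₀ + 1)) : K) ^ 2 =
      ((f₀ : R j₀) : K) - ((⟨G, hGR⟩ : R (j₀ + 1)) : K) ^ 2 := by
    have esq := congrArg (fun z : K => z ^ 2) hlaw
    show s j₁ ^ 2 * x ^ (d - 1) * W ^ 2 = s j₀ ^ 2 - G ^ 2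
    rw [hm, pow_mul]
    linear_combination esq + (G ^ 2 - s j₀ * G) * h2
  have hlaw₂' : ((f₂ : R (j₁ + 1)) : K) * x ^ (d + 1) * ((⟨W₁, hW₁R⟩ : R (j₁ + 1)) : K) ^ 2 =
      ((f₁ : R (j₀ + 1)) : K) - ((⟨G₁, hG₁R⟩ : R (j₁ + 1)) : K) ^ 2 := by
    have esq := congrArg (fun z : K => z ^ 2) hlaw₂
    show s j₂ ^ 2 * x ^ (d + 1) * W₁ ^ 2 = s j₁ ^ 2 - G₁ ^ 2
    rw [hde, pow_mul]
    linear_combination esq + (G₁ ^ 2 - s j₁ * G₁) * h2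
  have hlaw₃' : ((f₃ : R (j₂ + 1)) : K) * x₂ ^ (d - 1) * ((⟨W₂, hW₂R⟩ : R (j₂ + 1)) : K) ^ 2 =
      ((f₂ : R (j₁ + 1)) : K) - ((⟨G₂, hG₂R⟩ : R (j₂ + 1)) : K) ^ 2 := by
    have esq := congrArg (fun z : K => z ^ 2) hlaw₃
    show s N ^ 2 * x₂ ^ (d - 1) * W₂ ^ 2 = s j₂ ^ 2 - G₂ ^ 2
    rw [hm, pow_mul]
    linear_combination esq + (G₂ ^ 2 - s j₂ * G₂) * h2
  -- the cleaners, read in the fixed members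
  have hclean₁' : ∃ γ₁ : R (j₀ + 1), f₁ - γ₁ ^ 2 ∈ maximalIdeal (R (j₀ + 1)) ^ (d + 1) := by
    obtain ⟨_, hs', ⟨γ₁, hγ₁⟩, -⟩ := hν₁
    have hγR : (γ₁ : K) ∈ R (j₀ + 1) := by rw [← hRj₁]; exact γ₁.2
    exact ⟨⟨(γ₁ : K), hγR⟩,
      sub_sq_mem_pow_of_subring_eq hRj₁ (d + 1) (VisitLawPointStep.pow_mem_of_run hrun j₁) γ₁.2 hsj₁ hγR hγ₁⟩
  have hclean₂' : ∃ γ₂ : R (j₁ + 1), f₂ - γ₂ ^ 2 ∈ maximalIdeal (R (j₁ + 1)) ^ d := by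
    obtain ⟨_, hs', ⟨γ₂, hγ₂⟩, -⟩ := hclean₂
    have hγR : (γ₂ : K) ∈ R (j₁ + 1) := by rw [← hRj₂]; exact γ₂.2
    exact ⟨⟨(γ₂ : K), hγR⟩,
      sub_sq_mem_pow_of_subring_eq hRj₂ d (VisitLawPointStep.pow_mem_of_run hrun j₂) γ₂.2 hsj₂ hγR hγ₂⟩
  have hclean₃' : ∃ γ₃ : R (j₂ + 1), f₃ - γ₃ ^ 2 ∈ maximalIdeal (R (j₂ + 1)) ^ (d + 1) := by
    obtain ⟨_, hs', ⟨γ₃, hγ₃⟩, -⟩ := hνN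
    have hγR : (γ₃ : K) ∈ R (j₂ + 1) := by rw [← hRN]; exact γ₃.2
    exact ⟨⟨(γ₃ : K), hγR⟩,
      sub_sq_mem_pow_of_subring_eq hRN (d + 1) (VisitLawPointStep.pow_mem_of_run hrun N) γ₃.2 hsN hγR hγ₃⟩
  -- F4b
  obtain ⟨σ, τ, hσu, hτu, hrsop, hmem⟩ := binaryResidue_of_evenSatellite h2 (R j₀) (R (j₀ + 1)) (R (j₁ + 1)) (R (j₂ + 1)) h01 h12 h23
    (hreg _) (hreg _) (hreg _) (hreg _) (hdim _) (hdim _) (hdim _) (hdim _) ⟨x, hx.1.fst⟩ hx.2.1 u hxu u' hu hm₁ hrat₀'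
    v hxv v' hv hm₂ hrat₁' ⟨x₂, hx₂R⟩ hx₂.2.1 w hw0L hx₂w w' hw hm₃ hrat₂' hde f₀ G₀ hG₀
    f₁ ⟨G, hGR⟩ ⟨W, hWR⟩ hlaw₁' hclean₁' f₂ ⟨G₁, hG₁R⟩ ⟨W₁, hW₁R⟩ hlaw₂' hclean₂' f₃ ⟨G₂, hG₂R⟩ ⟨W₂, hW₂R⟩ hlaw₃' hclean₃'
  -- the form `Ψ` and the valuations (as F3ʳᵘⁿ)
  obtain ⟨y, hy, m, hm', hym⟩ := Submodule.mem_sup.mp hmem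
  have hrange : Set.range ![σ, τ] = {σ, τ} := by
    ext z
    simp only [Set.mem_range, Set.mem_insert_iff, Set.mem_singleton_iff, Fin.exists_fin_two, Matrix.cons_val_zero,
      Matrix.cons_val_one]
    constructor
    · rintro (h | h) <;> [exact Or.inl h.symm; exact Or.inr h.symm]
    · rintro (h | h) <;> [exact Or.inl h.symm; exact Or.inr h.symm]
  rw [← hrange] at hy
  obtain ⟨Ψ, hΨ, hΨev⟩ := exists_isHomogeneous_of_mem_span_pow ![σ, τ] d hy
  have hvx0 : O.valuation x ≠ 0 := (map_ne_zero _).mpr hx.2.1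
  have hum : ∀ j, u' j ∈ maximalIdeal (R (j₀ + 1)) := fun j =>
    hm₁ ▸ Ideal.subset_span (Set.mem_insert_of_mem _ ⟨j, rfl⟩)
  have hvalu : ∀ ρ : R j₀, ρ ∈ Ideal.span (Set.range u) → O.valuation (ρ : K) < O.valuation x := by
    intro ρ hρ
    obtain ⟨c, hc⟩ := Ideal.mem_span_range_iff_exists_fun.mp hρ
    set ρ' : R (j₀ + 1) := ∑ j, ⟨(c j : K), h01 (c j).2⟩ * u' j with hρ'
    have hρ'm : ρ' ∈ maximalIdeal (R (j₀ + 1)) := Ideal.sum_mem _ fun j _ => Ideal.mul_mem_left _ _ (hum j)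
    have hρK : (ρ : K) = x * (ρ' : K) := by
      rw [← hc, hρ']
      push_cast
      rw [Finset.mul_sum]
      refine Finset.sum_congr rfl fun j _ => ?_
      rw [hu j]; ring
    have hv' : O.valuation (ρ' : K) < 1 := (hval _ ρ').mp hρ'm
    rw [hρK, map_mul]
    calc O.valuation x * O.valuation (ρ' : K) < O.valuation x * 1 := mul_lt_mul_of_pos_left hv' (pos_iff_ne_zero.mpr hvx0)
      _ = O.valuation x := mul_one _
  refine ⟨hloc j₀, hs₀, G₀, σ, τ, Ψ, hrsop, hΨ, ?_, hvalu σ hσu, hvalu τ hτu⟩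
  have : (⟨s j₀ ^ 2, hs₀⟩ : R j₀) - G₀ ^ 2 - MvPolynomial.eval ![σ, τ] Ψ = m := by
    rw [hΨev, ← hym]; ring
  rw [this]; exact hm'

end Summit.ResolutionOfSingularities.ResolutionOfSingularities.Theorems.SwitchingDichotomy.BinaryResidue

end
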